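import Summits.HodgeConjecture.HodgeConjecture.Theorems.R90S4OneDimBaseChange        -- ★ p861888 `bcChar`, `bcChar_apply`, `det_epsLoc` (brings ★ `quotConj`, `coe_quotConj`, `normOneUnits`, `conjLocal_conjLocal_cm`, ★ `R90S4LocalBaseChangeDefs`)
import Summits.HodgeConjecture.HodgeConjecture.Theorems.R90S4TwistedNormMapLocal     -- ★ p861787 `IsEpsNormPair` («`γ ∈ 𝒩(δ)`»)
import Literature.NumberTheory.Rogawski1990.XiLocalCharacter                          -- ★ `localDet` (`det : G_v → E¹_v`), `coe_localDet`
import HarnessLib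

/-!
# R90-TF · S4 «Ch. 13.1–2», brick (W5-B3) NORM-TORI, character germ — `ψ̃(det δ) = ψ(det γ)` for `γ ∈ 𝒩(δ)`
# (Rogawski 1990, §12.4 p. 180 «`ψ̃(x) = ψ(x∕x̄)`»; §12.5 p. 187 «`α̃(δ) = α(γ)` for `γ ∈ 𝒩(δ)`»; §3.11 p. 34 the norm map)

Cell `hodgecm-mathlib`, crux H413 (`stmt-HodgeConjecture-24833`, lane `--supports … --as helper`), route of record `HCCMUnconditional` (no route verbs;
count-neutral).  Programme R90-TF, section S4 (dealer K2E2-plan (g6)); seat K2E3-p36 (g2), owner of brick B3 «NORM-TORI» of the road to the named input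
(1D-CT) `stub_R90_S4_oneDimCharTransfer` (RULING S4-R11 (c), `R90/STATUS.md` 2026-09-04T22:36:15Z; census `R90/S4/CENSUS-1DCT.K2E3-p36.md`).  This file is the
CHARACTER GERM of B3, for the (W6-B4) assembly `Theorems/R90S4OneDimCharTransferOfWeylPair.lean` (R90-C131-p03 (g2)): the termwise identity
`α̃ = α ∘ 𝒩` of p. 187 at `α = ψ ∘ det`.  THEOREMS ONLY — no `def`, no instance, no notation, no `sorry`; ★-only imports.

HONEST LABEL: HC_CM is proved only modulo the 7 printed citations (2 remaining named inputs: hLiu418 = stmt-HodgeConjecture-24832, h413 =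
stmt-HodgeConjecture-24833) until rung 0 closes.  Pure algebra of the norm map; discharges nothing by itself.

THE MATHEMATICS.  `N(δ) = δ ε_v(δ)` with `det ε_v(g) = (det g)̄⁻¹` (★ `det_epsLoc`), so `det N(δ) = det δ ∕ (det δ)̄ = quotConj(det δ)` — the element of
`E¹_v` at which `ψ̃ = ψ ∘ quotConj` (★ `bcChar`) evaluates `det δ`.  If `γ ∈ 𝒩(δ)`, i.e. `γ ∈ G_v` is `G̃_v`-conjugate to `N(δ)` (★ `IsEpsNormPair`), then
`det γ = det N(δ)` (the determinant is a class function of the commutative-valued `det : GL₃ → E_v^×`), hence `ψ̃(det δ) = ψ(det γ)` for EVERY character `ψ` of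
`E¹_v` — print's «`α̃(δ) = α(γ)` if `γ ∈ 𝒩(δ)`» (p. 187) for `α = ψ ∘ det`, and «`π̃ = ψ̃ ∘ det` … `ψ̃(x) = ψ(x∕x̄)`» (Prop. 13.2.2 (b), p. 201).
[cite: Rogawski1990, §12.4 p. 180; §12.5 p. 187; §13.2 Prop. 13.2.2 (b) p. 201; §3.11 p. 34]
-/

set_option autoImplicit false
-- the mandated namespace repeats the single-problem summit's segment (`HodgeConjecture.HodgeConjecture`)
set_option linter.dupNamespace false

noncomputable section

open scoped NumberField Matrix MatrixGroups

namespace Summit.HodgeConjecture.HodgeConjecture.R90.S4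

open Literature.NumberTheory.Rogawski1990 Literature.NumberTheory.Rogawski1990.Ch4Sec10
open Literature.NumberTheory.Automorphic Literature.NumberTheory.Automorphic.UnitaryGroup
open IsDedekindDomain NumberField

variable (L : Type) [Field L] [NumberField L] [IsCMField L] (Φ : GL (Fin 3) L)
  (v : HeightOneSpectrum (𝓞 ↥(maximalRealSubfield L)))

/-- **`det N(δ) = det δ ∕ (det δ)̄ = quotConj(det δ)` in `E_v^×`**: the determinant of the norm `N(δ) = δ ε_v(δ)` (★ `det_epsLoc`: `det ε_v(g) = (det g)̄⁻¹`).
[cite: Rogawski1990, §3.11 p. 34; §12.4 p. 180] -/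
theorem det_epsNorm_epsLoc (δ : GtLoc L v) :
    Matrix.GeneralLinearGroup.det (epsNorm (epsLoc L Φ v) δ) =
      Matrix.GeneralLinearGroup.det δ *
        (Units.map (conjLocal L (IsCMField.complexConj L) v : LocalRing L v →* LocalRing L v) (Matrix.GeneralLinearGroup.det δ))⁻¹ := by
  rw [epsNorm, map_mul, det_epsLoc]

/-- **`det γ = det N(δ)` for `γ ∈ 𝒩(δ)`** (`γ` is `G̃_v`-conjugate to `N(δ)`, and `det` is conjugation-invariant with values in the commutative `E_v^×`).
[cite: Rogawski1990, §3.11 p. 34] -/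
theorem det_coe_eq_det_epsNorm_of_isEpsNormPair {δ : GtLoc L v} {γ : (UnitaryGroup.cmDatum L 3 (Φ : Matrix (Fin 3) (Fin 3) L)).Local v}
    (hγ : IsEpsNormPair L Φ v δ γ) :
    Matrix.GeneralLinearGroup.det (γ.val : GtLoc L v) = Matrix.GeneralLinearGroup.det (epsNorm (epsLoc L Φ v) δ) := by
  obtain ⟨x, hx⟩ := isConj_iff.mp hγ
  rw [← hx, map_mul, map_mul, map_inv, mul_inv_eq_iff_eq_mul, mul_comm]

/-- **`quotConj(det δ) = det γ` in `E¹_v` for `γ ∈ 𝒩(δ)`** — the element of the norm-one torus at which `ψ̃` evaluates `det δ` IS the determinant of the norm class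
(★ `localDet γ`, whose underlying unit is `det γ` by ★ `coe_localDet`).  `hJ` = «`det Φ` is a unit» (for the form of record ★ `isUnit_antidiagOne_det L 3`).
[cite: Rogawski1990, §12.4 p. 180; §12.5 p. 187] -/
theorem quotConj_det_eq_localDet_of_isEpsNormPair (hJ : IsUnit ((Φ : GL (Fin 3) L) : Matrix (Fin 3) (Fin 3) L).det)
    {δ : GtLoc L v} {γ : (UnitaryGroup.cmDatum L 3 (Φ : Matrix (Fin 3) (Fin 3) L)).Local v} (hγ : IsEpsNormPair L Φ v δ γ) :
    quotConj (conjLocal L (IsCMField.complexConj L) v) (conjLocal_conjLocal_cm L v) (Matrix.GeneralLinearGroup.det δ) =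
      localDet (IsCMField.complexConj L) v hJ γ := by
  apply Subtype.ext
  rw [coe_quotConj, coe_localDet, det_coe_eq_det_epsNorm_of_isEpsNormPair L Φ v hγ, det_epsNorm_epsLoc]

/-- **`ψ̃(det δ) = ψ(det γ)` for `γ ∈ 𝒩(δ)` and EVERY character `ψ` of `E¹_v`** (★ `bcChar L v ψ = ψ̃`, `ψ̃(x) = ψ(x∕x̄)`; ★ `localDet` = `det : G_v → E¹_v`): print's
«`α̃(δ) = α(γ)` if `γ ∈ 𝒩(δ)`» (p. 187) for the stable class function `α = ψ ∘ det` of `G_v`, whose `α̃` is `ψ̃ ∘ det` — the termwise identity of the (1D-CT) comparison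
`∫_{G̃_v} φ · ψ̃(det) = ∫_{G_v} f · ψ(det)` (Prop. 12.4.1 ∕ Prop. 13.2.2 (b)). [cite: Rogawski1990, §12.5 p. 187; §12.4 p. 180; §13.2 Prop. 13.2.2 (b) p. 201] -/
theorem bcChar_det_eq_of_isEpsNormPair (ψ : ↥(normOneUnits (conjLocal L (IsCMField.complexConj L) v)) →* ℂˣ)
    (hJ : IsUnit ((Φ : GL (Fin 3) L) : Matrix (Fin 3) (Fin 3) L).det)
    {δ : GtLoc L v} {γ : (UnitaryGroup.cmDatum L 3 (Φ : Matrix (Fin 3) (Fin 3) L)).Local v} (hγ : IsEpsNormPair L Φ v δ γ) :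
    bcChar L v ψ (Matrix.GeneralLinearGroup.det δ) = ψ (localDet (IsCMField.complexConj L) v hJ γ) := by
  rw [bcChar_apply, quotConj_det_eq_localDet_of_isEpsNormPair L Φ v hJ hγ]

/-- **`ψ̃ ∘ det` is constant on ε-conjugacy classes** (it is an ε-class function — indeed ε-STABLE, depending on `δ` only through `N(δ)` up to conjugacy):
`ψ̃(det (y δ ε_v(y)⁻¹)) = ψ̃(det δ)`, since `det(y δ ε_v(y)⁻¹) = det δ · (det y)(det y)̄` and `ψ̃` kills norms (★ `bcChar_mul_map_conjLocal`).
[cite: Rogawski1990, §12.4 p. 180; §12.5 p. 186] -/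
theorem bcChar_det_mul_mul_inv_epsLoc (ψ : ↥(normOneUnits (conjLocal L (IsCMField.complexConj L) v)) →* ℂˣ) (y δ : GtLoc L v) :
    bcChar L v ψ (Matrix.GeneralLinearGroup.det (y * δ * (epsLoc L Φ v y)⁻¹)) = bcChar L v ψ (Matrix.GeneralLinearGroup.det δ) := by
  have hdet : Matrix.GeneralLinearGroup.det (y * δ * (epsLoc L Φ v y)⁻¹) =
      Matrix.GeneralLinearGroup.det y *
          Units.map (conjLocal L (IsCMField.complexConj L) v : LocalRing L v →* LocalRing L v) (Matrix.GeneralLinearGroup.det y) *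
        Matrix.GeneralLinearGroup.det δ := by
    rw [map_mul, map_mul, map_inv, det_epsLoc, inv_inv, mul_right_comm]
  rw [hdet, map_mul, bcChar_mul_map_conjLocal, one_mul]

end Summit.HodgeConjecture.HodgeConjecture.R90.S4

end
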